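import Summits.HubbardSuperconductivity.HubbardSuperconductivity.Theses.AnisotropyChord
import Summits.HubbardSuperconductivity.HubbardSuperconductivity.Theorems.AnisotropyChordDoobJohnsonChordDefs
import Summits.HubbardSuperconductivity.HubbardSuperconductivity.Theorems.AnisotropyChordDoobJohnsonChordPlan
import Summits.HubbardSuperconductivity.HubbardSuperconductivity.Theorems.AnisotropyChordChordXYTwoStateIdentity
import Summits.HubbardSuperconductivity.HubbardSuperconductivity.Theorems.AnisotropyChordDoobJohnsonChordLogSlopeChord
import Summits.HubbardSuperconductivity.HubbardSuperconductivity.Theorems.AnisotropyChordBipartiteClassFunction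
import Literature.Probability.LatticeModels.TorusBipartite
import Literature.MathematicalPhysics.QuantumLattice.SpinChainsLiebMattisProofs
import Summits.HubbardSuperconductivity.HubbardSuperconductivity.Theorems.AnisotropyChordThermalChordOfConcave
import Summits.HubbardSuperconductivity.HubbardSuperconductivity.Theorems.AnisotropyChordCondensateSlabDefs
import Summits.HubbardSuperconductivity.HubbardSuperconductivity.Theorems.AnisotropyChordCondensateSlabStubGroundStateLimit
import Summits.HubbardSuperconductivity.HubbardSuperconductivity.Theorems.AnisotropyChordCondensateSlabSmallBeta

/-!
# Crux `ChordXY` (stmt-HubbardSuperconductivity-8146) — LEAD SKELETON (lead-8146-chordxy g0, 2026-08-31):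
# line `doob-johnson-chord` [MAIN, namespace `…Cruxes.ChordXY.DoobJohnsonChord`] + line `condensate-slab`
# [SECOND, namespace `…Cruxes.ChordXY.CondensateSlab`], merged so that the stubs of BOTH director-approved
# lines are registered on the crux at once (one registered skeleton per crux; stubs_max = 4).
#
# RESHAPE (lead-8146-chordxy g1, 2026-08-31): PLAN A of STUB-PLAN-stub_frozenFieldChord.md («diagonal log-slope»)
# does not pass through the frozen-field stub — its H3 ("LFFRA from the diagonal log-slope bound") is
# mis-chained (LFFRA is global in the base point) — but its H2, the DIAGONAL LOG-SLOPE BOUND, closes the crux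
# DIRECTLY (`chordXY_of_logSlope_smooth`, landed: smooth Perron family by the implicit function theorem,
# Doob–Hellmann–Feynman, mean-value theorem on `Λ_M(u)/(1+u)`).  H2 is therefore registered as a third stub
# `DoobJohnsonChord.stub_logSlopeBound` with its own composition `ChordXY_of_logSlopeBound`; the original
# stubs and compositions are kept verbatim.

Each section keeps its crux-plan skeleton verbatim except that (i) the statement abbreviations are the
LANDED ones (`Theorems/AnisotropyChordDoobJohnsonChordDefs`, `Theorems/AnisotropyChordCondensateSlabDefs`),
(ii) closed stubs are replaced by their landed theorems, and (iii) each section has its own composition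
`ChordXY_of : Theses.AnisotropyChord.ChordXY` BY NAME.  Open stubs after this reshape:
`DoobJohnsonChord.stub_frozenFieldChord` (XL, idea-bound), `CondensateSlab.stub_slabConcave_smallBeta` (M),
`CondensateSlab.stub_slabConcavity_propagates` (XL, idea-bound), `CondensateSlab.stub_slabGroundStateLimit`
(M; proof landed def-free as `tendsto_slabCondensate_groundState`, by-name closure follows registration).
HONEST: nothing in this file proves `ChordXY`; superconductivity in the Hubbard model is not advanced.
-/

/-!
# Crux `ChordXY` (stmt-HubbardSuperconductivity-8146) — line `doob-johnson-chord` (crux-plan, 2026-08-31)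

DOOB–JOHNSON CALCULUS FOR THE CONDENSATE.  Notation: `H_M(Δ) = xxzHamiltonian 1 (torusGraph 2 M) (-1) Δ`
on the `S^z_tot = 0` sector of the even `M × M` torus, `O = S⁺_tot S⁻_tot`, `Λ(φ) = Re⟨φ, O φ⟩`.
`O` is entrywise non-negative and symmetric in the `S^z` basis (its off-diagonal part is the adjacency
matrix of the TELEPORT GRAPH `σ → σ + e_x − e_y`), and `H_M(Δ)` is stoquastic, so the sector ground state
`ψ_Δ` may be taken entrywise `> 0` on the sector (Perron–Frobenius, PROVED below from the tree).  Two moves: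

* `stub_tangentBound` (S–M; CLOSED by name 2026-08-31, `Theorems/AnisotropyChordDoobJohnsonChordDefs`) — the AM–GM TANGENT BOUND of the concave functional `p ↦ Λ(√p)` at the point
  `q = ψ²`: for every amplitude `φ` supported inside `supp ψ`,
  `Λ(φ) ≤ Σ_σ |φ(σ)|² g_ψ(σ)`, `g_ψ(σ) = (Oψ)(σ)/ψ(σ)` the Doob–Johnson LOCAL FIELD (mixed estimator) of `O`
  in the state `ψ` (per teleport edge `2ab ≤ a² ψ(τ)/ψ(σ) + b² ψ(σ)/ψ(τ)`; equality at `φ = ψ`).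
* `stub_frozenFieldChord` (XL, HARDEST; the idea card's transfer `C⁺ = FrozenFieldChord`) — the chord
  inequality with the field FROZEN at `Δ` and averaged in the XY law:
  `(1+Δ) · E_{|ψ₀|²}[g_Δ] ≤ E_{ψ_Δ²}[g_Δ] = Λ_M(Δ)` for `Δ ∈ [-1,0]`, `ψ₀` any normalised XY sector ground
  state, `ψ_Δ ≥ 0` the Perron ground state at `Δ`.  ED (idea card, seat-2 calc/out_frozen_*): the AM–GM
  penalty `E_{p₀}[g_Δ] − Λ(0)` is ≤ 0.020 of the chord slack at N = 16, 18, 20, N-stable.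
PROVED here (no sorry): `sectorPerron_condensate` (a real non-negative normalised sector ground state
exists for every `Δ`, is `> 0` wherever any sector vector lives, and every normalised sector ground state is
a phase times it — from `xxz_sector_perron_pos`), `lam_smul`, and the COMPOSITION `ChordXY_of : ChordXY`:
`(1+Δ)Λ(ψ₀) ≤ (1+Δ)E_{p₀}[g_Δ] ≤ Λ(ψ_Δ) = Λ(ψ)` (tangent bound with `ψ = ψ_Δ`, `1+Δ ≥ 0`, frozen-field
chord, phase invariance of `Λ`).  PLAN LAYER (defs + proved reductions, not stubs): the frozen-field RATIO
ANTITONICITY `FrozenFieldRatioAntitone` ((1+s)E_{p_t}[g_Δ] ≤ (1+t)E_{p_s}[g_Δ] for Δ ≤ s ≤ t ≤ 0) implies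
`stub_frozenFieldChord` (`frozenFieldChord_of_ratioAntitone`); its infinitesimal form is the flow
inequality `(1+s)∂_s E_{p_s}[g_Δ] ≤ E_{p_s}[g_Δ]`, whose diagonal `s = Δ` is the log-slope bound
`(1+Δ)Λ'(Δ) ≤ Λ(Δ)` by the Doob–Hellmann–Feynman identity `Λ'(Δ) = Σ_σ g_Δ(σ) ∂_Δ p_Δ(σ)` (line card §Hardest).
Disproof used: none exists for this crux (`ledger crux ls`: no Disproof.lean).  Dead lines honoured:
loop-russo (costume) is not re-entered — no loop / Russo-formula object appears here.
HONEST: nothing in this file proves `ChordXY`; superconductivity in the Hubbard model is not advanced.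
-/

set_option linter.dupNamespace false

noncomputable section

namespace Summit.HubbardSuperconductivity.HubbardSuperconductivity.Cruxes.ChordXY.DoobJohnsonChord

open Matrix Finset
open scoped ContDiff
open Literature.MathematicalPhysics.QuantumLattice Literature.Probability.LatticeModels
open Summit.HubbardSuperconductivity.HubbardSuperconductivity.Theses.AnisotropyChord
open Summit.HubbardSuperconductivity.HubbardSuperconductivity.Theorems.AnisotropyChord
  (xxz_sector_perron_pos)

/-! ### Vocabulary
The statement abbreviations `Config`, `Hxxz`, `Otot`, `lam`, `IsGS`, `ofReal`, `field` of this line are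
LANDED verbatim in `Theorems/AnisotropyChordDoobJohnsonChordDefs.lean` (namespace
`…Theorems.AnisotropyChord.DoobJohnsonChord`, lead g0, 2026-08-31) and opened here, so that stubs closed
BY NAME in `Theorems/` are literally the registered signatures. -/

open Summit.HubbardSuperconductivity.HubbardSuperconductivity.Theorems.AnisotropyChord.DoobJohnsonChord
  hiding stub_tangentBound

/-! ### The two registered stubs -/

/-- STUB 1 (S–M) — CLOSED — AM–GM TANGENT BOUND of the concave geometric-mean functional at `q = ψ²`:
for `ψ ≥ 0` and `φ` supported inside `supp ψ`, `Λ(φ) ≤ Σ_σ |φ σ|² g_ψ(σ)`.  Ingredients: `O` has real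
entries `≥ 0` and is symmetric in the `S^z` basis; per entry `2|φ σ||φ τ| ≤ |φ σ|² ψ τ/ψ σ + |φ τ|² ψ σ/ψ τ`.
Doob (1957) h-transform / Johnson's mixed estimator; [folklore]. -/
theorem stub_tangentBound :
    ∀ (M : ℕ) [NeZero M] (ψ : Config M → ℝ) (φ : Config M → ℂ),
      (∀ σ, 0 ≤ ψ σ) → (∀ σ, φ σ ≠ 0 → 0 < ψ σ) →
        lam M φ ≤ ∑ σ, ‖φ σ‖ ^ 2 * field M ψ σ :=
  -- CLOSED (lead g0, 2026-08-31): landed BY NAME in `Theorems/AnisotropyChordDoobJohnsonChordDefs.lean`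
  -- (proof `chordXY_tangentBound`, `Theorems/AnisotropyChordChordXYTangentBound.lean`, p825583).
  Summit.HubbardSuperconductivity.HubbardSuperconductivity.Theorems.AnisotropyChord.DoobJohnsonChord.stub_tangentBound

/-- STUB 2 (XL, HARDEST) — FROZEN-FIELD CHORD (the idea card's transfer `C⁺`): for even `M ≥ 4`,
`Δ ∈ [-1,0]`, `ψ₀` a normalised XY (`Δ = 0`) sector ground state and `ψ ≥ 0` the real non-negative
normalised sector ground state at `Δ`, `(1+Δ) · Σ_σ |ψ₀ σ|² g_ψ(σ) ≤ Λ(ψ)`.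
Why it might fail: it is STRONGER than `ChordXY` by the AM–GM penalty (measured ≤ 2 % of the slack at
N ≤ 20; untested for M ≥ 6); the all-`M` mechanism is IDEA-NEEDED (line card).  Sources: idea card
doob-johnson-chord (seat-2 calc/out_frozen_16/18/20), TRIAGE-r1-1 and TRIAGE-r1-2. -/
theorem stub_frozenFieldChord :
    ∀ (M : ℕ) [NeZero M], Even M → 4 ≤ M → ∀ Δ ∈ Set.Icc (-1:ℝ) 0,
      ∀ (ψ₀ : Config M → ℂ) (ψ : Config M → ℝ),
        IsGS M 0 ψ₀ → IsGS M Δ (ofReal M ψ) → (∀ σ, 0 ≤ ψ σ) →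
          (1 + Δ) * (∑ σ, ‖ψ₀ σ‖ ^ 2 * field M ψ σ) ≤ lam M (ofReal M ψ) := by
  sorry

/-- STUB 3 (XL⁻; PLAN A's H2 = the DIAGONAL LOG-SLOPE BOUND; registered by the lead g1 reshape,
2026-08-31) — for every even `M ≥ 4` and every `C^∞` family `Ψ` of real non-negative normalised
`S^z_tot = 0` sector ground states of `H_M(·)` (such a family EXISTS and is unique —
`exists_smooth_perronFamily`, smooth Perron branch by the implicit function theorem),
`(1+u) · d/du Λ(Ψ u) ≤ Λ(Ψ u)` for `u ∈ (-1,0)`; equivalently `u ↦ Λ_M(u)/(1+u)` is antitone on `(-1,0]`.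
Analytic handle (landed): `d/du Λ(Ψ u) = Σ_σ g_u(σ) ∂_u p_u(σ) = 2⟨Ψ', Oᵣ Ψ u⟩` (Doob–Hellmann–Feynman,
`hasDerivAt_lam_family_doob`) with `Ψ'` the solution of the first-order equation
`(T_u - E_u) Ψ' = (E_u' - T') Ψ u`, `Ψ' ⊥ Ψ u` (`PerronBranch.firstOrder_eigenvector_equation`), i.e.
`2(1+u)⟨D̃ψ_u, R_u Ō ψ_u⟩ ≤ Λ_M(u)`.  Why it might fail: it implies `ChordXY` (planar LRO at every
`Δ ∈ (-1,0]`); Cauchy–Schwarz in the resolvent inner product is NOT enough (crit-1 K5, N = 36: CS ratio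
≈ 0.10 growing ≈ N^0.68), so a proof needs the cancellations between the local Ising source and the global
pair field — the `d = 2` input; numerically `(1+u)Λ'/Λ ≤ 0.25` (K2, N ≤ 20).  Weaker than concavity of
`Λ_M` (line concavity_af); incomparable with `stub_frozenFieldChord`. [research] -/
theorem stub_logSlopeBound :
    ∀ (M : ℕ) [NeZero M], Even M → 4 ≤ M → ∀ Ψ : ℝ → Config M → ℝ, ContDiff ℝ ∞ Ψ →
      (∀ u, IsGS M u (ofReal M (Ψ u))) → (∀ u σ, 0 ≤ Ψ u σ) →
      ∀ u ∈ Set.Ioo (-1:ℝ) 0,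
        (1 + u) * deriv (fun v => lam M (ofReal M (Ψ v))) u ≤ lam M (ofReal M (Ψ u)) := by
  sorry

/-! ### Glue
`sectorPerron_condensate`, `lam_smul`, `lam_nonneg`, `sum_sq_mul_field_self`, `norm_sq_ofReal`,
`norm_sq_eq_of_phase` and the ratio-antitonicity reductions are LANDED in
`Theorems/AnisotropyChordDoobJohnsonChordPlan.lean` (lead g0) and used from there. -/

/-! ### The composition: the crux `ChordXY` BY NAME from the two stubs -/

/-- COMPOSITION TO THE CRUX BY NAME.  `(1+Δ)·Λ(ψ₀) ≤ (1+Δ)·E_{|ψ₀|²}[g_{ψ_Δ}] ≤ Λ(ψ_Δ) = Λ(ψ)`: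
`stub_tangentBound` at the Perron state `ψ_Δ` (`supp ψ₀ ⊆` sector `⊆ supp ψ_Δ`), `1+Δ ≥ 0`,
`stub_frozenFieldChord`, and phase invariance of `Λ` (`ψ = a ψ_Δ`, `|a| = 1`, `sectorPerron_condensate`).
Sorries live only in the two `stub_*`. -/
theorem ChordXY_of : ChordXY := by
  intro M _ hE h4 Δ hΔ ψ₀ ψ hmem₀ hn₀ heig₀ hmem hn heig
  obtain ⟨ψr, hnn, hGS, hsupp, huniq⟩ := sectorPerron_condensate M hE Δ
  have hT : lam M ψ₀ ≤ ∑ σ, ‖ψ₀ σ‖ ^ 2 * field M ψr σ :=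
    stub_tangentBound M ψr ψ₀ hnn (hsupp ψ₀ hmem₀)
  have hF : (1 + Δ) * (∑ σ, ‖ψ₀ σ‖ ^ 2 * field M ψr σ) ≤ lam M (ofReal M ψr) :=
    stub_frozenFieldChord M hE h4 Δ hΔ ψ₀ ψr ⟨hmem₀, hn₀, heig₀⟩ hGS hnn
  obtain ⟨a, ha1, hψa⟩ := huniq ψ ⟨hmem, hn, heig⟩
  have hlamψ : lam M ψ = lam M (ofReal M ψr) := by
    rw [hψa, lam_smul, ha1, one_pow, one_mul]
  have h1 : 0 ≤ 1 + Δ := by linarith [hΔ.1]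
  have key : (1 + Δ) * lam M ψ₀ ≤ lam M ψ :=
    calc (1 + Δ) * lam M ψ₀ ≤ (1 + Δ) * (∑ σ, ‖ψ₀ σ‖ ^ 2 * field M ψr σ) :=
          mul_le_mul_of_nonneg_left hT h1
      _ ≤ lam M (ofReal M ψr) := hF
      _ = lam M ψ := hlamψ.symm
  exact key

/-- SECOND COMPOSITION TO THE CRUX BY NAME (PLAN A-direct, lead g1): `ChordXY` from `stub_logSlopeBound`
alone — the log-slope bound along the smooth Perron family integrates (mean value theorem on
`Λ_M(u)/(1+u)`, continuity at `0`) to `(1+Δ)Λ_M(0) ≤ Λ_M(Δ)`, and phase uniqueness transports it to arbitrary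
normalised sector ground states (`chordXY_of_logSlope_smooth`, `Theorems/…DoobJohnsonChordLogSlopeChord`).
Sorries live only in `stub_logSlopeBound`. -/
theorem ChordXY_of_logSlopeBound : ChordXY :=
  Summit.HubbardSuperconductivity.HubbardSuperconductivity.Theorems.AnisotropyChord.DoobJohnsonChord.chordXY_of_logSlope_smooth
    stub_logSlopeBound

/-! ### Plan layer (the reductions are landed in `Theorems/AnisotropyChordDoobJohnsonChordPlan.lean`) -/

/-- PLAN B₁ — FROZEN-FIELD RATIO ANTITONICITY (global form): for `-1 ≤ Δ ≤ s ≤ t ≤ 0`, with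
`ψs, ψt ≥ 0` the real normalised sector ground states at `s`, `t` and the field `g_Δ` of the ground state
`ψΔ ≥ 0` FROZEN at `Δ`, `(1+s) · E_{ψt²}[g_Δ] ≤ (1+t) · E_{ψs²}[g_Δ]`, i.e. `u ↦ E_{p_u}[g_Δ]/(1+u)` is
antitone on `[Δ,0]`.  At `(s,t) = (Δ,0)` this is `stub_frozenFieldChord` (`frozenFieldChord_of_ratioAntitone`). -/
def FrozenFieldRatioAntitone : Prop :=
  ∀ (M : ℕ) [NeZero M], Even M → 4 ≤ M → ∀ (Δ s t : ℝ), -1 ≤ Δ → Δ ≤ s → s ≤ t → t ≤ 0 →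
    ∀ (ψΔ ψs ψt : Config M → ℝ),
      IsGS M Δ (ofReal M ψΔ) → (∀ σ, 0 ≤ ψΔ σ) →
      IsGS M s (ofReal M ψs) → (∀ σ, 0 ≤ ψs σ) →
      IsGS M t (ofReal M ψt) → (∀ σ, 0 ≤ ψt σ) →
        (1 + s) * (∑ σ, ψt σ ^ 2 * field M ψΔ σ) ≤ (1 + t) * (∑ σ, ψs σ ^ 2 * field M ψΔ σ)

/-- PLAN B₂ — the same, LOCALLY in `(s,t)` (`t - s ≤ δ`, `δ = δ(M, Δ) > 0` uniform on the compact pencil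
`[Δ,0]`): the integrated form of the FLOW INEQUALITY `(1+u) ∂_u E_{p_u}[g_Δ] ≤ E_{p_u}[g_Δ]`
(`∂_u E_{p_u}[g_Δ] = Σ_σ g_Δ(σ) ∂_u p_u(σ) = 2 Cov_{p_u}(g_Δ, w_u)`, `∂_u ψ_u = w_u ψ_u`, `w_u` solving the
Doob-transformed Poisson equation with source the centred ISING energy — a first-order, linear-response
statement; at `u = Δ` it is the log-slope bound `(1+Δ)Λ'(Δ) ≤ Λ(Δ)` by Doob–Hellmann–Feynman, since
`E_{p_Δ}[∂_Δ g_Δ] = 0`).  Chains to the hardest stub (`frozenFieldChord_of_localRatioAntitone`). -/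
def LocalFrozenFieldRatioAntitone : Prop :=
  ∀ (M : ℕ) [NeZero M], Even M → 4 ≤ M → ∀ Δ ∈ Set.Icc (-1:ℝ) 0, ∀ ψΔ : Config M → ℝ,
    IsGS M Δ (ofReal M ψΔ) → (∀ σ, 0 ≤ ψΔ σ) →
    ∃ δ : ℝ, 0 < δ ∧ ∀ (s t : ℝ), Δ ≤ s → s ≤ t → t ≤ 0 → t - s ≤ δ →
      ∀ (ψs ψt : Config M → ℝ),
        IsGS M s (ofReal M ψs) → (∀ σ, 0 ≤ ψs σ) → IsGS M t (ofReal M ψt) → (∀ σ, 0 ≤ ψt σ) →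
          (1 + s) * (∑ σ, ψt σ ^ 2 * field M ψΔ σ) ≤ (1 + t) * (∑ σ, ψs σ ^ 2 * field M ψΔ σ)

/-- REDUCTION (proved): global ratio antitonicity on `[Δ, 0]` implies the hardest stub
`stub_frozenFieldChord` (take `s = Δ`, `t = 0`; `E_{ψΔ²}[g_Δ] = Λ(ψ_Δ)`; the XY law `|ψ₀|²` equals `ψ_0²`
for the Perron state `ψ_0` by phase uniqueness). -/
theorem frozenFieldChord_of_ratioAntitone (hR : FrozenFieldRatioAntitone) :
    ∀ (M : ℕ) [NeZero M], Even M → 4 ≤ M → ∀ Δ ∈ Set.Icc (-1:ℝ) 0,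
      ∀ (ψ₀ : Config M → ℂ) (ψ : Config M → ℝ),
        IsGS M 0 ψ₀ → IsGS M Δ (ofReal M ψ) → (∀ σ, 0 ≤ ψ σ) →
          (1 + Δ) * (∑ σ, ‖ψ₀ σ‖ ^ 2 * field M ψ σ) ≤ lam M (ofReal M ψ) :=
  -- landed: `Theorems/AnisotropyChordDoobJohnsonChordPlan.lean`
  Summit.HubbardSuperconductivity.HubbardSuperconductivity.Theorems.AnisotropyChord.DoobJohnsonChord.frozenFieldChord_of_ratioAntitone
    hR

/-- REDUCTION (proved): the LOCAL ratio antitonicity chains along an equally spaced partition of the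
pencil `[Δ, 0]` (mesh `≤ δ`, Perron states at the nodes from `sectorPerron_condensate`, all factors
`1 + u ≥ 1 + Δ > 0`) to the hardest stub `stub_frozenFieldChord`; the endpoint `Δ = -1` is `0 ≤ Λ`. -/
theorem frozenFieldChord_of_localRatioAntitone (hL : LocalFrozenFieldRatioAntitone) :
    ∀ (M : ℕ) [NeZero M], Even M → 4 ≤ M → ∀ Δ ∈ Set.Icc (-1:ℝ) 0,
      ∀ (ψ₀ : Config M → ℂ) (ψ : Config M → ℝ),
        IsGS M 0 ψ₀ → IsGS M Δ (ofReal M ψ) → (∀ σ, 0 ≤ ψ σ) →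
          (1 + Δ) * (∑ σ, ‖ψ₀ σ‖ ^ 2 * field M ψ σ) ≤ lam M (ofReal M ψ) :=
  -- landed: `Theorems/AnisotropyChordDoobJohnsonChordPlan.lean`
  Summit.HubbardSuperconductivity.HubbardSuperconductivity.Theorems.AnisotropyChord.DoobJohnsonChord.frozenFieldChord_of_localRatioAntitone
    hL

end Summit.HubbardSuperconductivity.HubbardSuperconductivity.Cruxes.ChordXY.DoobJohnsonChord

/-!
# Crux `ChordXY` (stmt-HubbardSuperconductivity-8146) — line `condensate-slab`
# (crux-plan, 2026-08-31): CONCAVITY IN THE ANISOTROPY OF THE IMAGINARY-TIME SLAB CONDENSATE AT EVERY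
# INVERSE TEMPERATURE ⇒ the route item `ChordXY` by name

Notation: `H_M(Δ) = xxzHamiltonian 1 (torusGraph 2 M) (-1) Δ = -Σ_{xy} (SˣSˣ + SʸSʸ + Δ SᶻSᶻ)` on the
`M × M` torus, `P₀ = sectorProj M` (projection onto `S^z_tot = 0`), `A = condensateOp M = S⁺_tot S⁻_tot`,
`𝟙` the all-ones vector of the `Sᶻ`-configuration basis (so `P₀ 𝟙` = the uniform superposition of the
half-filled configurations = `|S = M²/2, Sᶻ = 0⟩`, the sector component of the fully `x`-polarised state).

The SLAB VECTOR `v_β(Δ) = e^{-β H_M(Δ)} P₀ 𝟙` and the SLAB CONDENSATE (a Rayleigh quotient, NOT a trace)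
`Λˢ_{β,M}(Δ) = Re ⟨v_β, A v_β⟩ / ⟨v_β, v_β⟩` — the condensate measured in the middle of an imaginary-time
slab of thickness `2β` with the symmetry-breaking boundary state `P₀𝟙` at both ends. `Λˢ_{0,M} ≡ S(S+1)`,
`S = M²/2` (constant in `Δ`), and `Λˢ_{β,M}(Δ) → Λ(ψ_Δ) = Re⟨ψ_Δ, A ψ_Δ⟩` (the ground-state condensate of
the crux) as `β → ∞`, because `⟨ψ_Δ, P₀𝟙⟩ > 0` for the Perron ground state.

Stubs (registered):
* `stub_slabConcave_smallBeta` [rung, size M–L] — for every even `M ≥ 4` there is `β₀(M) > 0` with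
  `Δ ↦ Λˢ_{β,M}(Δ)` concave on `[-1,0]` for `0 < β ≤ β₀` (second-order expansion
  `Λˢ = S(S+1) − β²(1−Δ)² κ_M + O_M(β³)`, `κ_M > 0`; GRAPH-BLIND — carries no `d = 2` information, it is the
  base of the continuation and the witness that the functional is concave for a structural reason).
* `stub_slabConcavity_propagates` [HARDEST, XL, research] — concavity on a base interval `(0, β₀]`
  propagates to EVERY `β > 0` (even `M ≥ 4`, the `M × M` torus). This is where `d = 2` must enter: on the
  ring `C₁₆` the slab condensate turns CONVEX near `Δ = 0⁻` from `β ≈ 0.75` on (seat-1 numerics), so no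
  graph-blind argument can prove it. A typed sufficient condition is proved below
  (`slabConcavity_propagates_of_increments`: concave `β`-increments).
* `stub_slabGroundStateLimit` [size M] — `Λˢ_{β,M}(Δ) → Re⟨ψ, Aψ⟩` for every normalised sector ground state
  `ψ` of `H_M(Δ)` (sectorwise power method `groundProjection_of_groundOverlap` + Perron–Frobenius
  `xxz_sector_perron_pos` / `xxzTorus_sectorGroundSpace_unique`).
PROVED here: `slabCondensate_nonneg`, `slabConcavity_propagates_of_increments`, the composition
`chordXY_of_slab` and `ChordXY_of : ChordXY` (sorries ONLY in `stub_*`).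

Why this is not line `concavity_af` (GS concavity) in costume: the stubs quantify over EVERY finite `β`
(a statement false on rings and ladders-in-β-monotone form, true on all 735 tested torus points), and the
finite-`β` object `v_β` is a positive vector of the stoquastic cone with an explicit boundary, amenable to
path-space / log-concavity tools that the ground state alone does not expose. Why not line `thermal_af`:
the periodic trace `tr(P₀e^{-βH}A)/tr(P₀e^{-βH})` at fixed `β` and `M → ∞` is a KT/high-temperature
quantity (`≈ χ·M²`, convex in `Δ` near `0⁻` at large `M`), the slab is not (boundary LRO at every `β`).
HONEST: nothing here proves `ChordXY`, 8146, or any summit statement; superconductivity in the Hubbard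
model is NOT advanced by this file.
Disproof used: none exists for this crux (no `Cruxes/ChordXY/Disproof.lean`). Dead lines avoided:
`loop-russo` (costume, no inequality) — not used; `∀ᶠ β` typing (TRIAGE-r1-1 (i), TRIAGE-r1-2 §2.3(a)) —
replaced by `∀ β > 0`.
-/

open scoped ComplexOrder

namespace Summit.HubbardSuperconductivity.HubbardSuperconductivity.Cruxes.ChordXY.CondensateSlab

open Matrix Filter Topology
open Literature.MathematicalPhysics.QuantumLattice Literature.Probability.LatticeModels
open Summit.HubbardSuperconductivity.HubbardSuperconductivity.Theses.AnisotropyChord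
open Summit.HubbardSuperconductivity.HubbardSuperconductivity.Theorems.AnisotropyChord
  hiding stub_slabConcave_smallBeta

/-! ### Vocabulary
The statement abbreviations `slabVec`, `slabCondensate` of this line (and `slabCondensate_nonneg`) are
LANDED verbatim in `Theorems/AnisotropyChordCondensateSlabDefs.lean` (namespace
`…Theorems.AnisotropyChord.CondensateSlab`, lead g0, 2026-08-31) and opened here, so that stubs closed BY
NAME in `Theorems/` are literally the registered signatures. -/

open Summit.HubbardSuperconductivity.HubbardSuperconductivity.Theorems.AnisotropyChord.CondensateSlab
  hiding stub_slabGroundStateLimit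

/-- STUB 1 (rung, graph-blind) — CLOSED — SMALL-`β` CONCAVITY: for every even `M ≥ 4` there is `β₀ > 0` such that
`Δ ↦ Λˢ_{β,M}(Δ)` is concave on `[-1,0]` for all `β ∈ (0, β₀]`. Mechanism: `P₀𝟙` is the top eigenvector of
`A` on the sector (eigenvalue `S(S+1)`, simple) and an eigenvector of the isotropic part `-Σ 𝐒_x·𝐒_y` of
`H_M(Δ) = -Σ 𝐒_x·𝐒_y + (1-Δ) Σ SᶻSᶻ`, so `Λˢ_{β,M}(Δ) = S(S+1) - β²(1-Δ)²κ_M + O_M(β³)` uniformly on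
`[-1,0]` with `κ_M = ⟨(D P₀𝟙)^⊥, (S(S+1) - A)(D P₀𝟙)^⊥⟩/‖P₀𝟙‖² > 0`, `D = Σ SᶻSᶻ`; hence
`∂²_Δ Λˢ = -2β²κ_M + O_M(β³) < 0` for small `β`. [folklore perturbation theory; Kato, *Perturbation Theory
for Linear Operators*, II §2] -/
theorem stub_slabConcave_smallBeta :
    ∀ (M : ℕ) [NeZero M], Even M → 4 ≤ M → ∃ β₀ : ℝ, 0 < β₀ ∧ ∀ β ∈ Set.Ioc (0:ℝ) β₀,
      ConcaveOn ℝ (Set.Icc (-1:ℝ) 0) (fun Δ : ℝ => slabCondensate M β Δ) :=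
  -- CLOSED (lead g0, 2026-08-31): landed BY NAME in `Theorems/AnisotropyChordCondensateSlabSmallBeta.lean` (p827099;
  -- helpers …CondensateSlabPolarised p826639, …KappaPos p826792, …Calculus p826821).
  Summit.HubbardSuperconductivity.HubbardSuperconductivity.Theorems.AnisotropyChord.stub_slabConcave_smallBeta

/-- STUB 2 (HARDEST; the research step, where `d = 2` must enter) — CONCAVITY PROPAGATES IN `β`: on the
even `M × M` torus, `M ≥ 4`, if `Δ ↦ Λˢ_{β,M}(Δ)` is concave on `[-1,0]` for all `β` in some base interval
`(0, β₀]`, then it is concave on `[-1,0]` for EVERY `β > 0`. False for the ring `C₁₆` in place of the torus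
(convex near `Δ = 0⁻` from `β ≈ 0.75`; seat-1 NUMERICS), observed at all 630 tested `(Δ, β)` points of the
tori `4×4`, `√18×√18`, `√20×√20`. Candidate tools (none yet adequate — IDEA-NEEDED): concavity of the
`β`-increments (`slabConcavity_propagates_of_increments` below; observed on the three tori, fails on the
`2×8` ladder), a maximum principle for `u = ∂²_Δ Λˢ` along the flow `∂_β v = -H v`, log-concavity of the
two-boundary loop measure in the Ising coupling `g = 1-Δ ∈ [1,2]` using the SU(2) point `g = 2`.
[research; Kennedy–Lieb–Shastry, J. Stat. Phys. 53 (1988); Tasaki (2020) §4.1] -/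
theorem stub_slabConcavity_propagates :
    ∀ (M : ℕ) [NeZero M], Even M → 4 ≤ M → ∀ β₀ : ℝ, 0 < β₀ →
      (∀ β ∈ Set.Ioc (0:ℝ) β₀, ConcaveOn ℝ (Set.Icc (-1:ℝ) 0) (fun Δ : ℝ => slabCondensate M β Δ)) →
      ∀ β : ℝ, 0 < β → ConcaveOn ℝ (Set.Icc (-1:ℝ) 0) (fun Δ : ℝ => slabCondensate M β Δ) := by
  sorry

/-- STUB 3 — CLOSED — GROUND-STATE LIMIT OF THE SLAB: for even `M ≥ 2`, every real `Δ` and every normalised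
`S^z_tot = 0` ground state `ψ` of `H_M(Δ)`, `Λˢ_{β,M}(Δ) → Re⟨ψ, S⁺_tot S⁻_tot ψ⟩` as `β → ∞`. Proof plan:
`groundProjection_of_groundOverlap` with `K` = the sector, `v = P₀𝟙`, `w₀ = ψ`; the overlap `⟨ψ, P₀𝟙⟩ ≠ 0`
because the sector ground state is a multiple of the entrywise-positive Perron vector
(`xxz_sector_perron_pos`, `xxzTorus_sectorGroundSpace_unique`); the Rayleigh quotient is invariant under
the rescaling `e^{βE}` and continuous at the non-zero limit vector. [folklore; Bratteli–Robinson II §5.3.1;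
Tasaki (2020) §2.2, §4.1] -/
theorem stub_slabGroundStateLimit :
    ∀ (M : ℕ) [NeZero M], Even M → 2 ≤ M → ∀ (Δ : ℝ) (ψ : TensorIndex (TorusSite 2 M) 2 → ℂ),
      ψ ∈ spinZSector (Λ := TorusSite 2 M) 1 0 → star ψ ⬝ᵥ ψ = 1 →
      Matrix.mulVec (xxzHamiltonian 1 (torusGraph 2 M) (-1) Δ) ψ =
        ((lowestEnergyInSector 1 (xxzHamiltonian 1 (torusGraph 2 M) (-1) Δ) 0 : ℝ) : ℂ) • ψ →
      Tendsto (fun β : ℝ => slabCondensate M β Δ) atTop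
        (𝓝 ((star ψ ⬝ᵥ Matrix.mulVec ((∑ x : TorusSite 2 M, onSite x (spinRaise 1)) *
          (∑ y : TorusSite 2 M, onSite y (spinLower 1))) ψ).re)) :=
  -- CLOSED (lead g0, 2026-08-31): landed BY NAME in `Theorems/AnisotropyChordCondensateSlabStubGroundStateLimit.lean`
  -- (p825984; proof `tendsto_slabCondensate_groundState`, `Theorems/AnisotropyChordCondensateSlabGroundStateLimit.lean`, p825850).
  Summit.HubbardSuperconductivity.HubbardSuperconductivity.Theorems.AnisotropyChord.CondensateSlab.stub_slabGroundStateLimit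

/-- **Typed sufficient condition for STUB 2 (Entrance B, "concave increments")**: if for all
`0 < β ≤ β'` the increment `Δ ↦ Λˢ_{β',M}(Δ) - Λˢ_{β,M}(Δ)` is concave on `[-1,0]`, then concavity on a base
interval `(0, β₀]` propagates to every `β > 0` (`Λˢ_{β'} = Λˢ_{β} + increment`, `ConcaveOn.add`).
Equivalent, for smooth `Λˢ`, to `β ↦ ∂²_Δ Λˢ_{β,M}(Δ)` antitone — observed on the tori `4×4`, `√18`, `√20`
(seat-1 exact NUMERICS), but FALSE on the `2×8` ladder and DISFAVOURED at large `M` by the linear-spin-wave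
slab (F-slab-0, this line's falsifier file: the concavity margin at `Δ = 0⁻` dips below its `β = ∞` value
around `β ≈ L/6` and recovers). Recorded as the typed form of the "defect antitone" instrument reading, NOT a
registered stub and not the recommended bet. [bookkeeping] -/
theorem slabConcavity_propagates_of_increments (M : ℕ) [NeZero M]
    (hinc : ∀ β β' : ℝ, 0 < β → β ≤ β' →
      ConcaveOn ℝ (Set.Icc (-1:ℝ) 0) (fun Δ : ℝ => slabCondensate M β' Δ - slabCondensate M β Δ))
    (β₀ : ℝ) (hβ₀ : 0 < β₀)
    (hbase : ∀ β ∈ Set.Ioc (0:ℝ) β₀, ConcaveOn ℝ (Set.Icc (-1:ℝ) 0) (fun Δ : ℝ => slabCondensate M β Δ)) :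
    ∀ β : ℝ, 0 < β → ConcaveOn ℝ (Set.Icc (-1:ℝ) 0) (fun Δ : ℝ => slabCondensate M β Δ) := by
  intro β hβ
  by_cases hle : β ≤ β₀
  · exact hbase β ⟨hβ, hle⟩
  · have h := (hbase β₀ ⟨hβ₀, le_rfl⟩).add (hinc β₀ β hβ₀ (not_le.mp hle).le)
    refine h.congr ?_
    intro Δ _
    simp only [Pi.add_apply]
    ring

/-- COMPOSITION — the three stubs give the route item `ChordXY` (stmt-8146) BY NAME: for every `β > 0`
the slab condensate is concave on `[-1,0]` (stubs 1 + 2) and nonnegative at `-1`, hence above its chord,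
`(1+Δ)·Λˢ_{β,M}(0) ≤ Λˢ_{β,M}(Δ)` (`chord_of_concaveOn_of_nonneg`); both sides converge as `β → ∞` to
`(1+Δ)·Λ(ψ₀)` and `Λ(ψ)` (stub 3 at `Δ = 0` and at `Δ`), and `≤` passes to the limit. [folklore] -/
theorem chordXY_of_slab
    (h1 : ∀ (M : ℕ) [NeZero M], Even M → 4 ≤ M → ∃ β₀ : ℝ, 0 < β₀ ∧ ∀ β ∈ Set.Ioc (0:ℝ) β₀,
      ConcaveOn ℝ (Set.Icc (-1:ℝ) 0) (fun Δ : ℝ => slabCondensate M β Δ))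
    (h2 : ∀ (M : ℕ) [NeZero M], Even M → 4 ≤ M → ∀ β₀ : ℝ, 0 < β₀ →
      (∀ β ∈ Set.Ioc (0:ℝ) β₀, ConcaveOn ℝ (Set.Icc (-1:ℝ) 0) (fun Δ : ℝ => slabCondensate M β Δ)) →
      ∀ β : ℝ, 0 < β → ConcaveOn ℝ (Set.Icc (-1:ℝ) 0) (fun Δ : ℝ => slabCondensate M β Δ))
    (h3 : ∀ (M : ℕ) [NeZero M], Even M → 2 ≤ M → ∀ (Δ : ℝ) (ψ : TensorIndex (TorusSite 2 M) 2 → ℂ),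
      ψ ∈ spinZSector (Λ := TorusSite 2 M) 1 0 → star ψ ⬝ᵥ ψ = 1 →
      Matrix.mulVec (xxzHamiltonian 1 (torusGraph 2 M) (-1) Δ) ψ =
        ((lowestEnergyInSector 1 (xxzHamiltonian 1 (torusGraph 2 M) (-1) Δ) 0 : ℝ) : ℂ) • ψ →
      Tendsto (fun β : ℝ => slabCondensate M β Δ) atTop
        (𝓝 ((star ψ ⬝ᵥ Matrix.mulVec ((∑ x : TorusSite 2 M, onSite x (spinRaise 1)) *
          (∑ y : TorusSite 2 M, onSite y (spinLower 1))) ψ).re))) :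
    ChordXY := by
  intro M _ hE h4 Δ hΔ ψ₀ ψ hmem₀ hψ₀1 heig₀ hmem hψ1 heig
  have h2M : 2 ≤ M := le_trans (by norm_num) h4
  obtain ⟨β₀, hβ₀, hbase⟩ := h1 M hE h4
  have hall : ∀ β : ℝ, 0 < β → ConcaveOn ℝ (Set.Icc (-1:ℝ) 0) (fun Δ : ℝ => slabCondensate M β Δ) :=
    h2 M hE h4 β₀ hβ₀ hbase
  have hchord : ∀ᶠ β : ℝ in atTop, (1 + Δ) * slabCondensate M β 0 ≤ slabCondensate M β Δ :=
    (eventually_gt_atTop (0:ℝ)).mono fun β hβ =>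
      chord_of_concaveOn_of_nonneg (hall β hβ) (slabCondensate_nonneg M β (-1)) hΔ
  have hlim₀ := (h3 M hE h2M 0 ψ₀ hmem₀ hψ₀1 heig₀).const_mul (1 + Δ)
  have hlim := h3 M hE h2M Δ ψ hmem hψ1 heig
  exact le_of_tendsto_of_tendsto hlim₀ hlim hchord

/-- Entrance B composed to the crux: small-`β` concavity + concave `β`-increments + the ground-state limit
give `ChordXY` (via `slabConcavity_propagates_of_increments` and `chordXY_of_slab`). [bookkeeping] -/
theorem chordXY_of_slabIncrements
    (h1 : ∀ (M : ℕ) [NeZero M], Even M → 4 ≤ M → ∃ β₀ : ℝ, 0 < β₀ ∧ ∀ β ∈ Set.Ioc (0:ℝ) β₀,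
      ConcaveOn ℝ (Set.Icc (-1:ℝ) 0) (fun Δ : ℝ => slabCondensate M β Δ))
    (hinc : ∀ (M : ℕ) [NeZero M], Even M → 4 ≤ M → ∀ β β' : ℝ, 0 < β → β ≤ β' →
      ConcaveOn ℝ (Set.Icc (-1:ℝ) 0) (fun Δ : ℝ => slabCondensate M β' Δ - slabCondensate M β Δ))
    (h3 : ∀ (M : ℕ) [NeZero M], Even M → 2 ≤ M → ∀ (Δ : ℝ) (ψ : TensorIndex (TorusSite 2 M) 2 → ℂ),
      ψ ∈ spinZSector (Λ := TorusSite 2 M) 1 0 → star ψ ⬝ᵥ ψ = 1 →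
      Matrix.mulVec (xxzHamiltonian 1 (torusGraph 2 M) (-1) Δ) ψ =
        ((lowestEnergyInSector 1 (xxzHamiltonian 1 (torusGraph 2 M) (-1) Δ) 0 : ℝ) : ℂ) • ψ →
      Tendsto (fun β : ℝ => slabCondensate M β Δ) atTop
        (𝓝 ((star ψ ⬝ᵥ Matrix.mulVec ((∑ x : TorusSite 2 M, onSite x (spinRaise 1)) *
          (∑ y : TorusSite 2 M, onSite y (spinLower 1))) ψ).re))) :
    ChordXY :=
  chordXY_of_slab h1
    (fun M _ hE h4 β₀ hβ₀ hbase => slabConcavity_propagates_of_increments M (hinc M hE h4) β₀ hβ₀ hbase) h3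

/-- COMPOSITION TO THE CRUX BY NAME — `ChordXY` from the registered stubs (type = the route decl
`Summit.HubbardSuperconductivity.HubbardSuperconductivity.Theses.AnisotropyChord.ChordXY`; sorries live
only in `stub_*`). -/
theorem ChordXY_of : ChordXY :=
  chordXY_of_slab stub_slabConcave_smallBeta stub_slabConcavity_propagates stub_slabGroundStateLimit

end Summit.HubbardSuperconductivity.HubbardSuperconductivity.Cruxes.ChordXY.CondensateSlab

end
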